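import Literature.MathematicalPhysics.QuantumFieldTheory.Balaban1983to89.B13ConditioningSigmaLetters

/-!
# `Balaban1983to89.B13ConditioningSandwich` — T. Bałaban, *Renormalization group approach to lattice gauge field theories.
II. Cluster expansions*, Commun. Math. Phys. **116** (1988) 1–22 [Balaban1988RG2Cluster], (2.5) p. 12 (`C*Δ_kC`), p. 3,
(1.11) p. 5, p. 13, with [13] = [Balaban1985BackgroundPropagators] Thm 3.10 p. 416, Thm 3.12 p. 422–423 (*"we replace each
operator … by its random walk expansion"*): THE C-SANDWICH STEP OF THE CONDITIONED OPERATOR — ONE joint walk expansion of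
the fluctuation operator `Δ(σ,u) = Δ_k(σ,𝐔,𝐉)` IN PRINT's FORM (s-monomial terms with a walk reversal) on the fine bond set,
and a REAL, configuration- and σ-independent LOCAL operator `C` (bounded entries, finite range, finite fibres: the averaging
operator of (I.2.13)) give ONE joint walk expansion of `K = CᵀΔC` IN PRINT's FORM on the term's bond set, with letters that
do not depend on the torus size — by the tree's walk algebra (`B13JointWalkExpansion.jointWalkExpansion_const`,
`B13JointWalkExpansionAlgebra.jointWalkExpansion_mul_torus` twice)

statement-level bookkeeping over published theorems with citation tags; kernel-checked compositions of tree theorems;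
nothing here is a claim about the Yang–Mills mass gap.

WHY (cell `pub-ymgap`, D-0062 Track A, node N10 = [B13]; seat `pub-ymgap-dag-n10-c` g3, module 23).  After modules 17–22
the N10 record junction (`Summit…N10AtRecord11B13WalksBlockMonomialHolo`, p485539) displays NODE A per term as ONE expansion
of `K = C*Δ_k(σ,𝐔,𝐉)C` in print's form + ONE positivity + geometry.  Print's operator is a SANDWICH of the s-decorated
fluctuation operator between the real local `C` and its transpose; this file peels that layer generically: the expansion
slot of the junction reduces to ONE expansion of `Δ_k(σ,𝐔,𝐉)` itself — [13] Thms 3.10∕3.12 for the operators determining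
`Δ_k`, s-decorated by (1.11) (`B13Eq111SDecoupling`) — the (D4) producer's object one algebraic layer lower.  The
positivity slot (`Re CᵀΔ(0,0)C ≥ m₀`, print's positivity of the fluctuation form at `(U′,0)`) is NOT touched here.

WHAT THIS FILE PROVES (all `theorem`s; no `def`, no instance, no notation).
§1 `jointWalkExpansion_constLocal` — a real constant local operator `C` (`|C k i| ≤ 1`, `C k i ≠ 0 ⇒ d₁(loc k, loc′ i) ≤ r_C`)
   is its own one-term joint walk expansion at any rates `0 ≤ ρ`, `κ ≤ ρ − ε` with amplitude∕constant `e^{ρ r_C}` and the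
   one-point distance `d₁` (`jointWalkExpansion_const`); `jointWalkExpansion_constLocal_transpose` (the transposed reading).
§2 ★ `jointWalkExpansion_sandwich` — ONE expansion of `Δ` through `X` at `(R, ε₀, κ₀, K̄_Δ; ρ₀)` with distances dominating
   `d₁`, fibre bound `m_F` of the fine locations, and a junction rate `0 < μ`, `2μ ≤ ε₀, κ₀`, `κ₀ ≤ ρ₀ − ε₀` ⟹ ONE expansion
   of `CᵀΔC` through `X` at `(R, ε₀ − 2μ, κ₀ − 2μ, K̄_S; ρ₀ − 2μ)` with the explicit torus-size-free constant
   `K̄_S = (m_F c₀(1,μ)^ν)² c₀(1,μ)^{2ν} e^{ρ₀ r_C} e^{(ρ₀−μ) r_C} K̄_Δ`, terms `Cᵀ·T_ω·C`, the SAME σ-carrying sub-family.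
§3 ★ `structuredExpansion_sandwich` — PRINT's FORM IS PRESERVED: if `Δ`'s terms are s-monomials times σ-free operators with
   a walk reversal, so are `CᵀΔC`'s (`Cᵀ((∏σ)•T⁰)C = (∏σ)•(CᵀT⁰C)`, `(CᵀMC)ᵀ = CᵀMᵀC`) — the `∃ W T SX A D ρ J T0 rev, …`
   of the junction's binder `hKexp` for `K = CᵀΔC`, from the same data for `Δ`.
HONEST FRAMING: kernel-level bookkeeping (finite matrices, the tree's product calculus); NOTHING of Bałaban's `Δ_k(σ,𝐔,𝐉)` or
`C` is constructed — whether HIS fluctuation operator carries ONE such expansion k-uniformly at complex backgrounds is NODE A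
([13] Thms 3.10∕3.12, (1.11); node N06 s4 ∕ row (D4)), the INPUT; the positivity slot is untouched; count-neutral; NOT a
discharge of N10; no `sorry`, no new named fact; standard axioms; nothing continuum ∕ ℝ⁴ ∕ OS ∕ mass gap ∕ Clay.
-/

noncomputable section

namespace Literature.MathematicalPhysics.QuantumFieldTheory.Balaban1983to89.B13ConditioningSandwich

open Metric Set Finset
open scoped Matrix
open Literature.MathematicalPhysics.QuantumFieldTheory.Balaban1983to89
open Literature.MathematicalPhysics.QuantumFieldTheory.Balaban1983to89.B9SectDWalk (MajSumLe DomBy infConv)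
open Literature.MathematicalPhysics.QuantumFieldTheory.Balaban1983to89.B9Thm34Ext (toB6)
open Literature.MathematicalPhysics.QuantumFieldTheory.Balaban1983to89.B9Thm37GlueTorus
  (torusGeom tdist1 tdist1_nonneg tdist1_comm)
open Literature.MathematicalPhysics.QuantumFieldTheory.Balaban1983to89.TreeLengthTorus (TPt)
open Literature.MathematicalPhysics.QuantumFieldTheory.Balaban1983to89.B5TorusCover (UT)
open Literature.MathematicalPhysics.QuantumFieldTheory.Balaban1983to89.B13JointWalkExpansion
  (JointWalkExpansion jointWalkExpansion_const)
open Literature.MathematicalPhysics.QuantumFieldTheory.Balaban1983to89.B13JointWalkExpansionAlgebra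
  (jointWalkExpansion_mul_torus domBy_mul)

variable {d N' : ℕ} {ν : ℕ} {Nf : Fin ν → ℕ} [∀ i, NeZero (Nf i)]
variable {E : Type*} [NormedAddCommGroup E] [NormedSpace ℂ E]
variable {p n : Type} [Fintype p]
variable {c : B13.Consts}

/-! ## §1. A real constant local operator is its own one-term expansion -/

/-- One-term majorant families on `Unit`. [folklore] -/
private theorem majSumLe_unit {g : B6.Geometry} {K Kbar : g.Site → g.Site → ℝ} (hK : ∀ a b, 0 ≤ K a b)
    (hle : ∀ a b, K a b ≤ Kbar a b) : MajSumLe (fun (_ : Unit) a b => K a b) Kbar := by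
  intro S a b
  calc ∑ _ω ∈ S, K a b ≤ ∑ _ω ∈ (Finset.univ : Finset Unit), K a b :=
        Finset.sum_le_sum_of_subset_of_nonneg (Finset.subset_univ S) fun _ _ _ => hK a b
    _ = K a b := by simp
    _ ≤ Kbar a b := hle a b

omit [Fintype p] in
/-- **A REAL CONSTANT LOCAL OPERATOR IS ITS OWN ONE-TERM JOINT WALK EXPANSION** (the averaging operator `C` of (I.2.13):
configuration- and σ-independent, entries `|C k i| ≤ 1`, range `r_C`): at any walk rate `ρ ≥ 0`, drop `ε` and torus rate
`κ ≤ ρ − ε`, with amplitude and constant `e^{ρ r_C}`, the one-point distance `d₁` and EMPTY σ-carrying sub-family — rows `p`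
located by `locF`, columns `n` by `locN`. [cite: Balaban1988RG2Cluster, (2.5) p.12, (1.11) p.5; Balaban1985BackgroundPropagators, (3.107) p.416] -/
theorem jointWalkExpansion_constLocal (locF : p → UT Nf) (locN : n → UT Nf) (C : Matrix p n ℝ) (X : Finset (UT Nf))
    {rC : ℝ} (hCle : ∀ k i, |C k i| ≤ 1) (hCsupp : ∀ k i, C k i ≠ 0 → tdist1 Nf (locF k) (locN i) ≤ rC)
    {R ρ ε kap : ℝ} (hρ : 0 ≤ ρ) (hκ : kap ≤ ρ - ε) :
    JointWalkExpansion c locF locN (fun (_ : TPt d N' → ℂ) (_ : E) => C.map (algebraMap ℝ ℂ)) X R ε kap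
      (Real.exp (ρ * rC)) (fun (_ : Unit) (_ : TPt d N' → ℂ) (_ : E) => C.map (algebraMap ℝ ℂ)) (∅ : Set Unit)
      (fun _ => Real.exp (ρ * rC)) (fun _ => tdist1 Nf) ρ := by
  refine jointWalkExpansion_const c locF locN _ X (Real.exp_pos _).le (fun a b => tdist1_nonneg a b) (fun k i => ?_)
    (majSumLe_unit (fun a b => by positivity) fun a b => ?_)
  · -- the entry bound `|C k i| ≤ e^{ρ r_C} e^{−ρ d₁}` (support within range `r_C`)
    by_cases h0 : C k i = 0
    · simp only [Matrix.map_apply, h0, map_zero, norm_zero]; positivity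
    · have hd := hCsupp k i h0
      rw [Matrix.map_apply, Complex.coe_algebraMap, Complex.norm_real, Real.norm_eq_abs, ← Real.exp_add]
      calc |C k i| ≤ 1 := hCle k i
        _ = Real.exp 0 := (Real.exp_zero).symm
        _ ≤ Real.exp (ρ * rC + -(ρ * tdist1 Nf (locF k) (locN i))) :=
            Real.exp_le_exp.2 (by nlinarith [tdist1_nonneg (locF k) (locN i)])
  · -- the one-term majorant at the reduced rate is below the torus majorant (`κ ≤ ρ − ε`)
    exact mul_le_mul_of_nonneg_left (Real.exp_le_exp.2 (by nlinarith [tdist1_nonneg a b])) (Real.exp_pos _).le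

omit [Fintype p] in
/-- The transposed reading: `Cᵀ` (rows `n` by `locN`, columns `p` by `locF`) is its own one-term expansion with the same
letters. [cite: Balaban1988RG2Cluster, (2.5) p.12; Balaban1985BackgroundPropagators, (3.107) p.416] -/
theorem jointWalkExpansion_constLocal_transpose (locF : p → UT Nf) (locN : n → UT Nf) (C : Matrix p n ℝ)
    (X : Finset (UT Nf)) {rC : ℝ} (hCle : ∀ k i, |C k i| ≤ 1)
    (hCsupp : ∀ k i, C k i ≠ 0 → tdist1 Nf (locF k) (locN i) ≤ rC) {R ρ ε kap : ℝ} (hρ : 0 ≤ ρ) (hκ : kap ≤ ρ - ε) :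
    JointWalkExpansion c locN locF (fun (_ : TPt d N' → ℂ) (_ : E) => (C.map (algebraMap ℝ ℂ))ᵀ) X R ε kap
      (Real.exp (ρ * rC)) (fun (_ : Unit) (_ : TPt d N' → ℂ) (_ : E) => (C.map (algebraMap ℝ ℂ))ᵀ) (∅ : Set Unit)
      (fun _ => Real.exp (ρ * rC)) (fun _ => tdist1 Nf) ρ := by
  have h := jointWalkExpansion_constLocal (c := c) (d := d) (N' := N') (E := E) locN locF Cᵀ X (rC := rC)
    (fun i k => hCle k i) (fun i k hik => by rw [tdist1_comm]; exact hCsupp k i hik) (R := R) hρ hκ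
  have e : (Cᵀ.map (algebraMap ℝ ℂ) : Matrix n p ℂ) = (C.map (algebraMap ℝ ℂ))ᵀ := by rw [Matrix.transpose_map]
  rw [e] at h
  exact h

/-! ## §2. The sandwich `CᵀΔC` of ONE expansion of `Δ` -/

omit [Fintype p] in
/-- The one-point distance dominates itself. [folklore] -/
private theorem domBy_tdist1 : DomBy (toB6 (torusGeom Nf 0 0 0) 0 True) (tdist1 Nf) := fun _ _ => le_rfl

/-- **THE C-SANDWICH OF ONE JOINT WALK EXPANSION** ([13] p. 422: *"we replace each operator … by its random walk
expansion"*, for print's `C\*Δ_k(σ)C` of (2.5)): ONE expansion of `Δ(σ,u)` through `X` on the fine bond set (rows and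
columns located by `locF`, package `(R, ε₀, κ₀, K̄_Δ)`, walk rate `ρ₀`, distances dominating `d₁`), a real constant local
`C` (`|C k i| ≤ 1`, range `r_C`), a fibre bound `m_F` of `locF` and a junction rate `μ > 0` with `2μ ≤ ε₀`, `2μ ≤ κ₀`,
`κ₀ ≤ ρ₀ − ε₀` give ONE expansion of `(σ,u) ↦ Cᵀ·Δ(σ,u)·C` through `X` on the term's bond set (located by `locN`) at
`(R, ε₀ − 2μ, κ₀ − 2μ; ρ₀ − 2μ)` with terms `Cᵀ·T_ω·C` (indexed by `(Unit × W) × Unit`), the SAME σ-carrying sub-family,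
and a constant free of the torus size — `jointWalkExpansion_mul_torus` twice around §1.
[cite: Balaban1988RG2Cluster, (2.5) p.12, p.13, (1.11) p.5; Balaban1985BackgroundPropagators, (3.92)–(3.94) p.410, (3.107)–(3.108) p.416, p.422; Balaban1984PropagatorsII, Lemma 2.1 (2.61) p.234] -/
theorem jointWalkExpansion_sandwich {locF : p → UT Nf} {locN : n → UT Nf} (C : Matrix p n ℝ) {X : Finset (UT Nf)}
    {rC : ℝ} (hCle : ∀ k i, |C k i| ≤ 1) (hCsupp : ∀ k i, C k i ≠ 0 → tdist1 Nf (locF k) (locN i) ≤ rC)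
    {Δ : (TPt d N' → ℂ) → E → Matrix p p ℂ} {R ε₀ κ₀ KbarΔ ρ₀ : ℝ} {W : Type}
    {T : W → (TPt d N' → ℂ) → E → Matrix p p ℂ} {SX : Set W} {A : W → ℝ} {D : W → UT Nf → UT Nf → ℝ}
    (hΔ : JointWalkExpansion c locF locF Δ X R ε₀ κ₀ KbarΔ T SX A D ρ₀)
    (hdom : ∀ ω, DomBy (toB6 (torusGeom Nf 0 0 0) 0 True) (D ω))
    {mF : ℕ} (hfibF : ∀ y : UT Nf, (Finset.univ.filter fun k => locF k = y).card ≤ mF)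
    {μ : ℝ} (hμ : 0 < μ) (hμε : 2 * μ ≤ ε₀) (hμκ : 2 * μ ≤ κ₀) (hκε : κ₀ ≤ ρ₀ - ε₀) (hKΔ : 0 ≤ KbarΔ) :
    JointWalkExpansion c locN locN
      (fun σ u => (C.map (algebraMap ℝ ℂ))ᵀ * Δ σ u * C.map (algebraMap ℝ ℂ)) X R (ε₀ - μ - μ) (κ₀ - μ - μ)
      ((mF * B6.c0 1 μ ^ ν) * ((mF * B6.c0 1 μ ^ ν) * Real.exp (ρ₀ * rC) * KbarΔ * B6.c0 1 μ ^ ν)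
        * Real.exp ((ρ₀ - μ) * rC) * B6.c0 1 μ ^ ν)
      (fun (ω : (Unit × W) × Unit) σ u => (C.map (algebraMap ℝ ℂ))ᵀ * T ω.1.2 σ u * C.map (algebraMap ℝ ℂ))
      {ω | (ω.1.1 ∈ (∅ : Set Unit) ∨ ω.1.2 ∈ SX) ∨ ω.2 ∈ (∅ : Set Unit)}
      (fun ω => (mF * B6.c0 1 μ ^ ν) * ((mF * B6.c0 1 μ ^ ν) * (Real.exp (ρ₀ * rC) * A ω.1.2)
        * Real.exp ((ρ₀ - μ) * rC)))
      (fun ω => infConv (g := toB6 (torusGeom Nf 0 0 0) 0 True)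
        (infConv (g := toB6 (torusGeom Nf 0 0 0) 0 True) (tdist1 Nf) (D ω.1.2)) (tdist1 Nf)) (ρ₀ - μ - μ) := by
  have hε₀ : 0 ≤ ε₀ := by linarith
  have hρ₀ : 0 ≤ ρ₀ := by linarith
  -- (1) `Cᵀ` as a one-term expansion at `Δ`'s package, then `Cᵀ·Δ`
  have hCt := jointWalkExpansion_constLocal_transpose (c := c) (d := d) (N' := N') (E := E) locF locN C X hCle hCsupp
    (R := R) (ε := ε₀) (kap := κ₀) hρ₀ hκε
  have h1 := jointWalkExpansion_mul_torus hCt hΔ (fun _ => domBy_tdist1) hdom hfibF hμ (by linarith) (by linarith)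
    (by linarith) (Real.exp_pos _).le hKΔ
  -- (2) `C` as a one-term expansion at the product's package, then `(Cᵀ·Δ)·C`
  have hρ₁ : 0 ≤ ρ₀ - μ := by linarith
  have hC := jointWalkExpansion_constLocal (c := c) (d := d) (N' := N') (E := E) locF locN C X hCle hCsupp
    (R := R) (ε := ε₀ - μ) (kap := κ₀ - μ) hρ₁ (by linarith)
  have hK1 : 0 ≤ (mF * B6.c0 1 μ ^ ν) * Real.exp (ρ₀ * rC) * KbarΔ * B6.c0 1 μ ^ ν := by
    have := B6RandomWalk.c0_nonneg 1 μ; positivity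
  have h2 := jointWalkExpansion_mul_torus h1 hC (domBy_mul (fun _ => domBy_tdist1) hdom) (fun _ => domBy_tdist1) hfibF
    hμ (by linarith) (by linarith) (by linarith) hK1 (Real.exp_pos _).le
  -- (3) the product family IS the sandwich family (indices `(Unit × W) × Unit`)
  exact h2

/-! ## §3. Print's form is preserved by the sandwich -/

/-- Transposing a sandwich transposes the middle factor: `(CᵀMC)ᵀ = CᵀMᵀC`. [folklore] -/
private theorem transpose_sandwich (Cc : Matrix p n ℂ) (M : Matrix p p ℂ) : (Ccᵀ * M * Cc)ᵀ = Ccᵀ * Mᵀ * Cc := by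
  rw [Matrix.transpose_mul, Matrix.transpose_mul, Matrix.transpose_transpose, Matrix.mul_assoc]

/-- **PRINT's FORM SURVIVES THE C-SANDWICH** — the binder `hKexp` of the N10 record junction for `K = CᵀΔC` FROM the same
structured datum for `Δ`: ONE expansion of `Δ` through `X` (package `(R, ε₀, κ₀, K̄_Δ)`, rate `ρ₀`, distances dominating
`d₁`) whose terms are s-MONOMIALS times σ-free operators (`T ω σ u = (∏_{j∈J ω} σ_j) • T0 ω u`, print p. 3) and carry a
WALK REVERSAL (`T (rev ω) σ u = (T ω σ u)ᵀ`, [13] (3.107)), a real constant local `C`, a fibre bound of the fine locations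
and a junction rate `μ` (`2μ ≤ ε₀, κ₀`, `κ₀ ≤ ρ₀ − ε₀`) give: `∃ W′ T′ SX′ A′ D′ ρ′ J′ T0′ rev′`, ONE expansion of `CᵀΔC`
through `X` at `(R, ε₀ − 2μ, κ₀ − 2μ, K̄_S)` with s-monomial terms and a reversal — the monomials are `Δ`'s, the σ-free
parts are `Cᵀ·T0_ω·C`, the reversal is `Δ`'s (`(CᵀT_{rev ω}C) = (CᵀT_ωC)ᵀ`).
[cite: Balaban1988RG2Cluster, p.3, (1.11) p.5, (2.5) p.12, p.13, p.15; Balaban1985BackgroundPropagators, (3.107)–(3.108) p.416, p.422, Thm 3.12 p.423] -/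
theorem structuredExpansion_sandwich {locF : p → UT Nf} {locN : n → UT Nf} (C : Matrix p n ℝ)
    {X : Finset (UT Nf)} {rC : ℝ} (hCle : ∀ k i, |C k i| ≤ 1)
    (hCsupp : ∀ k i, C k i ≠ 0 → tdist1 Nf (locF k) (locN i) ≤ rC)
    {Δ : (TPt d N' → ℂ) → E → Matrix p p ℂ} {R ε₀ κ₀ KbarΔ ρ₀ : ℝ} {W : Type}
    {T : W → (TPt d N' → ℂ) → E → Matrix p p ℂ} {SX : Set W} {A : W → ℝ} {D : W → UT Nf → UT Nf → ℝ}
    (hΔ : JointWalkExpansion c locF locF Δ X R ε₀ κ₀ KbarΔ T SX A D ρ₀)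
    (hdom : ∀ ω, DomBy (toB6 (torusGeom Nf 0 0 0) 0 True) (D ω))
    (J : W → Finset (TPt d N')) (T0 : W → E → Matrix p p ℂ) (hmono : ∀ ω σ u, T ω σ u = (∏ j ∈ J ω, σ j) • T0 ω u)
    (rev : W ≃ W) (hrev : ∀ ω σ u i j, T (rev ω) σ u i j = T ω σ u j i)
    {mF : ℕ} (hfibF : ∀ y : UT Nf, (Finset.univ.filter fun k => locF k = y).card ≤ mF)
    {μ : ℝ} (hμ : 0 < μ) (hμε : 2 * μ ≤ ε₀) (hμκ : 2 * μ ≤ κ₀) (hκε : κ₀ ≤ ρ₀ - ε₀) (hKΔ : 0 ≤ KbarΔ) :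
    ∃ (W' : Type) (T' : W' → (TPt d N' → ℂ) → E → Matrix n n ℂ) (SX' : Set W') (A' : W' → ℝ)
      (D' : W' → UT Nf → UT Nf → ℝ) (ρ' : ℝ) (J' : W' → Finset (TPt d N')) (T0' : W' → E → Matrix n n ℂ) (rev' : W' ≃ W'),
      JointWalkExpansion c locN locN (fun σ u => (C.map (algebraMap ℝ ℂ))ᵀ * Δ σ u * C.map (algebraMap ℝ ℂ)) X R
          (ε₀ - μ - μ) (κ₀ - μ - μ)
          ((mF * B6.c0 1 μ ^ ν) * ((mF * B6.c0 1 μ ^ ν) * Real.exp (ρ₀ * rC) * KbarΔ * B6.c0 1 μ ^ ν)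
            * Real.exp ((ρ₀ - μ) * rC) * B6.c0 1 μ ^ ν) T' SX' A' D' ρ' ∧
        (∀ ω σ u, T' ω σ u = (∏ j ∈ J' ω, σ j) • T0' ω u) ∧ (∀ ω σ u i j, T' (rev' ω) σ u i j = T' ω σ u j i) := by
  refine ⟨(Unit × W) × Unit, _, _, _, _, _, fun ω => J ω.1.2,
    fun ω u => (C.map (algebraMap ℝ ℂ))ᵀ * T0 ω.1.2 u * C.map (algebraMap ℝ ℂ),
    ((Equiv.refl Unit).prodCongr rev).prodCongr (Equiv.refl Unit),
    jointWalkExpansion_sandwich C hCle hCsupp hΔ hdom hfibF hμ hμε hμκ hκε hKΔ, ?_, ?_⟩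
  · -- s-monomials pass through the constant sandwich
    rintro ⟨⟨w, ω⟩, w'⟩ σ u
    show (C.map (algebraMap ℝ ℂ))ᵀ * T ω σ u * C.map (algebraMap ℝ ℂ)
      = (∏ j ∈ J ω, σ j) • ((C.map (algebraMap ℝ ℂ))ᵀ * T0 ω u * C.map (algebraMap ℝ ℂ))
    rw [hmono, Matrix.mul_smul, Matrix.smul_mul]
  · -- the reversal of `Δ`'s family transposes the sandwiched term
    rintro ⟨⟨w, ω⟩, w'⟩ σ u i j
    have hT : T (rev ω) σ u = (T ω σ u)ᵀ := by
      ext a b; rw [Matrix.transpose_apply]; exact hrev ω σ u a b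
    show ((C.map (algebraMap ℝ ℂ))ᵀ * T (rev ω) σ u * C.map (algebraMap ℝ ℂ)) i j
      = ((C.map (algebraMap ℝ ℂ))ᵀ * T ω σ u * C.map (algebraMap ℝ ℂ)) j i
    rw [hT, ← transpose_sandwich, Matrix.transpose_apply]

end Literature.MathematicalPhysics.QuantumFieldTheory.Balaban1983to89.B13ConditioningSandwich

end
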